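import Summits.Ventures.PercRepro.TheoremNAll
import Summits.Ventures.PercRepro.MatroidTruncate

/-!
# PercRepro — C-025: the coloop step at every `q` and the `|E|`-induction wrapper at level `q + 1` (night-1, gen 0)

p2's `rls_two_all` (`TheoremNAll`) is the induction wrapper of record at `q = 2`. This file lifts its three
reduction steps to an arbitrary level `q + 1 ≥ 3` and packages the wrapper with ONE hypothesis — the SIMPLE,
RANK-`p`, COLOOP-FREE core — so that `C025` at level `q + 1` (every `p ≥ q + 3`) follows from `C025` at level `q`
(every `p ≥ q + 2`) plus that core:

* `phiK_succ_le_two_mul_add_two` — `Φ(p+1, q) ≤ 2·Φ(p, q) + 2` for `q < p` (Pascal on the numerator; mine-2 §23.1 (R):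
  `Φ(p+1, q) = (2Φ(p, q) + 2)·(p+1)/(p+q+1)`), the general form of typer-2's `phiTwo_succ_le`;
* `midCount_eq_of_isColoop_q` — `#Y_M(p+1, q+1) = 2·#Y_{M'}(p, q+1) + W_p(M') + W_{q+1}(M')` for a coloop `e`,
  `M' = M ＼ {e}` (the general form of `midCount_eq_of_isColoop`);
* **`sumForm_of_isColoop_q`** — LEMMA J₂ AT EVERY `q`: a coloop `e` with `r(M) = p + 1` reduces the sum form at
  `(p+1, q+1)` to the sum form of `M ＼ {e}` at `(p, q+1)` (trivial when `p = q + 2`, where `Φ(p, q+1) = 0`);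
* `RLS_of_le` — the body is trivial when `p ≤ q + 1`;
* `truncate` facts: the truncation to rank `p < r(M)` of a simple matroid is simple, has rank `p` and no coloop;
* `spans_of_pigeonhole`, `RLS_of_unspanned_q` — an element `e` spanned by one side of every partition of `E ∖ {e}` (a line
  with `≥ 4` points through `e`, or any pigeonhole configuration) closes the step with `D_e = 0` (Theorem F);
* **`rls_succ_all`** — THE WRAPPER AT LEVEL `q + 1`: strong induction on `|E|` (loops halve; a parallel pair is Theorem F
  `c025_step_of_delete_contract` with the induction hypothesis at `(p, q+1)` and level `q` at `(p − 1, q)`; `r(E) < p`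
  is empty; `r(E) > p` is truncated to rank `p` (Theorem K, `rls_of_truncate`); a coloop at `r(E) = p` is
  `sumForm_of_isColoop_q`; an element without an `e`-free partition is Theorem F again), leaving as the hypothesis
  `hcore` the SIMPLE, COLOOP-FREE, RANK-`p` matroids in which EVERY element admits an `e`-free partition;
* **`c025_three_of_core`** — `C025` at `q = 3` for every `p ≥ 5` from the `q = 3` core alone (level `2` is Theorem N
  `c025_of_q_two`).
`RLS M p q` is `ThmN.RLS` (the body of `C025`). Axioms: standard.
-/

open scoped Matroid

namespace PercRepro

open Finset

/-! ### The binomial step `Φ(p+1, q) ≤ 2Φ(p, q) + 2` -/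

/-- `Σ_{q<u<p+1} C(n+1, u) = 2·Σ_{q<u<p} C(n, u) + C(n, p) + C(n, q)` for `q < p` (Pascal, termwise). -/
lemma sum_choose_Ioo_succ (n q p : ℕ) (hqp : q < p) :
    ∑ u ∈ Finset.Ioo q (p + 1), (n + 1).choose u =
      2 * ∑ u ∈ Finset.Ioo q p, n.choose u + n.choose p + n.choose q := by
  have hqp' : q + 1 ≤ p := hqp
  clear hqp
  induction p, hqp' using Nat.le_induction with
  | base =>
    have h1 : Finset.Ioo q (q + 1 + 1) = {q + 1} := by
      ext x; simp only [Finset.mem_Ioo, Finset.mem_singleton]; omega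
    have h2 : Finset.Ioo q (q + 1) = ∅ := by
      ext x; simp only [Finset.mem_Ioo, Finset.notMem_empty, iff_false]; omega
    rw [h1, h2, Finset.sum_singleton, Finset.sum_empty, Nat.choose_succ_succ]
    ring
  | succ p hqp ih =>
    have h1 : Finset.Ioo q (p + 1 + 1) = insert (p + 1) (Finset.Ioo q (p + 1)) := by
      ext x; simp only [Finset.mem_Ioo, Finset.mem_insert]; omega
    have h2 : Finset.Ioo q (p + 1) = insert p (Finset.Ioo q p) := by
      ext x; simp only [Finset.mem_Ioo, Finset.mem_insert]; omega
    rw [h1, Finset.sum_insert (by simp), ih, h2, Finset.sum_insert (by simp), Nat.choose_succ_succ]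
    ring

/-- **`Φ(p+1, q) ≤ 2·Φ(p, q) + 2`** for `q < p` (mine-2 §23.1 (R): the coloop step always closes). -/
theorem phiK_succ_le_two_mul_add_two (p q : ℕ) (hqp : q < p) : phiK (p + 1) q ≤ 2 * phiK p q + 2 := by
  unfold phiK
  have hpos : (0 : ℚ) < ((p + q).choose p : ℚ) := by exact_mod_cast Nat.choose_pos (Nat.le_add_right p q)
  have hpos' : (0 : ℚ) < ((p + 1 + q).choose (p + 1) : ℚ) := by
    exact_mod_cast Nat.choose_pos (by omega)
  have hsum : (∑ u ∈ Finset.Ioo q (p + 1), ((p + 1 + q).choose u : ℚ)) =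
      2 * (∑ u ∈ Finset.Ioo q p, ((p + q).choose u : ℚ)) + 2 * ((p + q).choose p : ℚ) := by
    have h := sum_choose_Ioo_succ (p + q) q p hqp
    rw [show p + 1 + q = p + q + 1 by ring]
    have hsymm : (p + q).choose q = (p + q).choose p := by
      rw [add_comm p q]; exact Nat.choose_symm_add
    rw [hsymm] at h
    exact_mod_cast (by rw [h]; ring : (∑ u ∈ Finset.Ioo q (p + 1), (p + q + 1).choose u : ℕ) =
      2 * ∑ u ∈ Finset.Ioo q p, (p + q).choose u + 2 * (p + q).choose p)
  have hle : ((p + q).choose p : ℚ) ≤ ((p + 1 + q).choose (p + 1) : ℚ) := by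
    have : (p + q).choose p ≤ (p + q + 1).choose (p + 1) := by
      rw [Nat.choose_succ_succ]; exact Nat.le_add_right _ _
    rw [show p + 1 + q = p + q + 1 by ring]
    exact_mod_cast this
  rw [hsum, div_le_iff₀ hpos']
  have hS : (0 : ℚ) ≤ ∑ u ∈ Finset.Ioo q p, ((p + q).choose u : ℚ) := by positivity
  have key : (2 * (∑ u ∈ Finset.Ioo q p, ((p + q).choose u : ℚ)) + 2 * ((p + q).choose p : ℚ)) =
      (2 * ((∑ u ∈ Finset.Ioo q p, ((p + q).choose u : ℚ)) / ((p + q).choose p : ℚ)) + 2) *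
        ((p + q).choose p : ℚ) := by
    field_simp
  rw [key]
  have hnn : (0 : ℚ) ≤ 2 * ((∑ u ∈ Finset.Ioo q p, ((p + q).choose u : ℚ)) / ((p + q).choose p : ℚ)) + 2 := by
    positivity
  exact mul_le_mul_of_nonneg_left hle hnn

namespace Matroid

variable {α : Type} {M : _root_.Matroid α} [M.Finite]

/-- **`#Y_M(p+1, q+1) = 2·#Y_{M'}(p, q+1) + W_p(M') + W_{q+1}(M')`** for a coloop `e` and `q + 1 < p`
(`M' = M ＼ {e}`; the general form of `midCount_eq_of_isColoop`). -/
theorem midCount_eq_of_isColoop_q {e : α} (he : M.IsColoop e) {p q : ℕ} (hp : q + 1 < p) :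
    midCount M (p + 1) (q + 1) = 2 * midCount (M ＼ {e}) p (q + 1) + levelCount (M ＼ {e}) p +
      levelCount (M ＼ {e}) (q + 1) := by
  rw [midCount_eq_sum (p + 1) (q + 1) (by omega), midCount_eq_sum p (q + 1) hp]
  have hterm : ∀ u ∈ Finset.Ioo (q + 1) (p + 1),
      levelCount M u = levelCount (M ＼ {e}) u + levelCount (M ＼ {e}) (u - 1) := by
    intro u hu
    rw [Finset.mem_Ioo] at hu
    obtain ⟨v, rfl⟩ : ∃ v, u = v + 1 := ⟨u - 1, by omega⟩
    rw [Nat.add_sub_cancel]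
    exact levelCount_succ_eq_of_isColoop he v
  rw [Finset.sum_congr rfl hterm, Finset.sum_add_distrib]
  have hshift := sum_Ioo_succ_shift (fun v => levelCount (M ＼ {e}) v) q p
  rw [hshift]
  have h1 : Finset.Ioo (q + 1) (p + 1) = insert p (Finset.Ioo (q + 1) p) := by
    ext x; simp only [Finset.mem_Ioo, Finset.mem_insert]; omega
  have h2 : Finset.Ioo q p = insert (q + 1) (Finset.Ioo (q + 1) p) := by
    ext x; simp only [Finset.mem_Ioo, Finset.mem_insert]; omega
  rw [h1, h2, Finset.sum_insert (by simp), Finset.sum_insert (by simp)]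
  ring

/-- **Lemma J₂ at every level** (mine-2 §23.1 (R)): `e` a coloop, `r(M) = p + 1`, `q + 1 < p`; if `M ＼ {e}`
satisfies `Φ(p, q+1)·#U(p, q+1) ≤ #Y(p, q+1)` then `M` satisfies `Φ(p+1, q+1)·#U(p+1, q+1) ≤ #Y(p+1, q+1)`:
`#U_M = #U_{M'}`, `#Y_M = 2·#Y_{M'} + W_p(M') + W_{q+1}(M') ≥ (2Φ(p, q+1) + 2)·#U_{M'}` by the two injections, and
`Φ(p+1, q+1) ≤ 2Φ(p, q+1) + 2`. -/
theorem sumForm_of_isColoop_q {e : α} (he : M.IsColoop e) {p q : ℕ} (hp : q + 1 < p)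
    (hR : M.eRank = ((p + 1 : ℕ) : ℕ∞))
    (hIH : phiK p (q + 1) * (topCount (M ＼ {e}) p (q + 1) : ℚ) ≤ (midCount (M ＼ {e}) p (q + 1) : ℚ)) :
    phiK (p + 1) (q + 1) * (topCount M (p + 1) (q + 1) : ℚ) ≤ (midCount M (p + 1) (q + 1) : ℚ) := by
  have hU : topCount M (p + 1) (q + 1) = topCount (M ＼ {e}) p (q + 1) :=
    topCount_eq_of_isColoop_of_eRank he q hR
  rw [hU, midCount_eq_of_isColoop_q he hp]
  push_cast
  have hΦ := phiK_succ_le_two_mul_add_two p (q + 1) hp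
  have htop : (topCount (M ＼ {e}) p (q + 1) : ℚ) ≤ levelCount (M ＼ {e}) p := by
    exact_mod_cast topCount_le_levelCount_top p (q + 1)
  have hbot : (topCount (M ＼ {e}) p (q + 1) : ℚ) ≤ levelCount (M ＼ {e}) (q + 1) := by
    exact_mod_cast topCount_le_levelCount_bot p (q + 1)
  have hU0 : (0 : ℚ) ≤ topCount (M ＼ {e}) p (q + 1) := by positivity
  nlinarith [hΦ, hIH, htop, hbot, hU0]

end Matroid

namespace ThmN

variable {α : Type}

/-- `RLS M p q` is trivial when `p ≤ q + 1` (`Φ(p, q) = 0`). -/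
theorem RLS_of_le (M : Matroid α) [M.Finite] {p q : ℕ} (h : p ≤ q + 1) : RLS M p q := by
  unfold RLS
  have h0 : phiK p q = 0 := by
    unfold phiK
    rw [Finset.sum_eq_zero (fun u hu => by rw [Finset.mem_Ioo] at hu; omega), zero_div]
  rw [h0, zero_mul]
  positivity

/-- `RLS` in `topCount` / `midCount` vocabulary. -/
theorem RLS_iff (M : Matroid α) [M.Finite] (p q : ℕ) :
    RLS M p q ↔ phiK p q * (Matroid.topCount M p q : ℚ) ≤ (Matroid.midCount M p q : ℚ) :=
  Iff.rfl

/-- The loop step at every level (p3's halving lemmas). -/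
theorem RLS_of_loop_q (M : Matroid α) [M.Finite] {e : α} (he : M.IsLoop e) (p q : ℕ)
    (h : RLS (M ＼ {e}) p q) : RLS M p q := by
  unfold RLS at h ⊢
  have he' : e ∈ M.loops := he
  rw [ncard_U_eq_two_mul_of_loop he' p q, ncard_Y_eq_two_mul_of_loop he' p q]
  push_cast at h ⊢
  linarith

/-- Theorem F's step at `(p + 1, q + 1)` for a parallel pair: from `RLS (M ＼ {e}) (p+1) (q+1)` and
`RLS (M ／ {e}) p q`. -/
theorem RLS_of_parallel_q (M : Matroid α) [M.Finite] {p q : ℕ} {e e' : α} (he : M.Indep {e})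
    (he' : e' ∈ M.E) (hne : e' ≠ e) (hpar : e ∈ M.closure {e'})
    (h1 : RLS (M ＼ {e}) (p + 1) (q + 1)) (h2 : RLS (M ／ {e}) p q) : RLS M (p + 1) (q + 1) := by
  unfold RLS at h1 h2 ⊢
  exact c025_step_of_delete_contract he (spans_of_parallel he' hne hpar) p q h1 h2

/-- The coloop step at `r(E) = p + 1` and level `q + 1` (Lemma J₂ at every `q`). -/
theorem RLS_of_coloop_q (M : Matroid α) [M.Finite] {e : α} {p q : ℕ} (hp : q + 1 < p)
    (he : M.IsColoop e) (hR : M.eRank = ((p + 1 : ℕ) : ℕ∞)) (hIH : RLS (M ＼ {e}) p (q + 1)) :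
    RLS M (p + 1) (q + 1) := by
  rw [RLS_iff] at hIH ⊢
  exact Matroid.sumForm_of_isColoop_q he hp hR hIH

/-! ### Truncation to rank `p` keeps simplicity and kills coloops -/

/-- Pairs keep rank `2` in the truncation to rank `p ≥ 2`. -/
theorem truncate_pair_eRk (M : Matroid α) [M.Finite] {p : ℕ} (hp : 2 ≤ p)
    (hs : ∀ e ∈ M.E, ∀ f ∈ M.E, e ≠ f → M.eRk {e, f} = 2) :
    ∀ e ∈ (Matroid.truncate M p).E, ∀ f ∈ (Matroid.truncate M p).E, e ≠ f →
      (Matroid.truncate M p).eRk {e, f} = 2 := by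
  intro e he f hf hef
  rw [Matroid.truncate_ground] at he hf
  rw [Matroid.truncate_eRk, hs e he f hf hef]
  exact min_eq_left (by exact_mod_cast hp)

/-- The truncation to rank `p < r(M)` has rank `p`. -/
theorem truncate_eRank_eq (M : Matroid α) [M.Finite] {p : ℕ} (hp : (p : ℕ∞) < M.eRank) :
    (Matroid.truncate M p).eRank = (p : ℕ∞) := by
  rw [Matroid.truncate_eRank]
  exact min_eq_right hp.le

/-- The truncation to rank `p < r(M)` has no coloop: `E ∖ {e}` still has rank `≥ p` in `M`, hence rank `p`
in the truncation, so it spans. -/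
theorem truncate_no_coloop (M : Matroid α) [M.Finite] {p : ℕ} (hp : (p : ℕ∞) < M.eRank) (e : α) :
    ¬ (Matroid.truncate M p).IsColoop e := by
  intro hcol
  have heE' : e ∈ (Matroid.truncate M p).E := hcol.mem_ground
  have heE : e ∈ M.E := heE'
  rw [_root_.Matroid.isColoop_iff_notMem_closure_compl heE'] at hcol
  apply hcol
  have hsp : (Matroid.truncate M p).Spanning ((Matroid.truncate M p).E \ {e}) := by
    rw [_root_.Matroid.spanning_iff_eRk_le']
    refine ⟨?_, Set.sdiff_subset⟩
    rw [truncate_eRank_eq M hp, Matroid.truncate_ground, Matroid.truncate_eRk]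
    refine le_min ?_ le_rfl
    -- `r_M(E ∖ {e}) ≥ r(M) − 1 ≥ p`
    have h1 : M.eRank ≤ M.eRk (M.E \ {e}) + 1 := by
      have := M.eRk_insert_le_add_one e (M.E \ {e})
      rw [Set.insert_sdiff_singleton, Set.insert_eq_of_mem heE, ← M.eRank_def] at this
      exact this
    have h2 : (p : ℕ∞) + 1 ≤ M.eRank := Order.add_one_le_of_lt hp
    have h3 : (p : ℕ∞) + 1 ≤ M.eRk (M.E \ {e}) + 1 := h2.trans h1
    exact (ENat.add_le_add_iff_right (by simp)).1 h3
  rw [_root_.Matroid.spanning_iff_closure_eq] at hsp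
  rw [hsp]
  exact heE'

/-! ### Elements spanned by one side of every partition (the step closes with `D_e = 0`) -/

/-- **Pigeonhole spanning**: if a set `T ⊆ E ∖ {e}` with `2k ≤ |T| + 1` has `e` in the closure of EVERY `k`-subset, then every
`A ⊆ E ∖ {e}` spans `e` on at least one side (one side contains `k` points of `T`) — the hypothesis `hunsp` of
`c025_step_of_delete_contract`; `k = 2`, `|T| = 3` is a line with four points through `e`, `k = 3`, `|T| = 5` a plane
through `e` whose `5`-point trace spans `e` by every triple (mine-2 §6 (6.4)). -/
theorem spans_of_pigeonhole (M : Matroid α) {e : α} (T : Finset α) (hT : (T : Set α) ⊆ M.E \ {e}) (k : ℕ)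
    (hcard : 2 * k ≤ T.card + 1) (hspan : ∀ T' ⊆ T, T'.card = k → e ∈ M.closure (T' : Set α)) :
    ∀ A ⊆ M.E \ {e}, e ∈ M.closure A ∨ e ∈ M.closure ((M.E \ {e}) \ A) := by
  classical
  intro A _
  have hsplit := Finset.card_filter_add_card_filter_not (s := T) (fun x => x ∈ A)
  rcases Nat.lt_or_ge (T.filter (fun x => x ∈ A)).card k with h1 | h1
  · have h2 : k ≤ (T.filter (fun x => x ∉ A)).card := by omega
    obtain ⟨T', hT'sub, hT'card⟩ := Finset.exists_subset_card_eq h2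
    right
    refine M.closure_subset_closure ?_ (hspan T' (hT'sub.trans (Finset.filter_subset _ _)) hT'card)
    intro x hx
    have hx' := hT'sub hx
    rw [Finset.mem_filter] at hx'
    exact ⟨hT (by exact_mod_cast hx'.1), hx'.2⟩
  · obtain ⟨T', hT'sub, hT'card⟩ := Finset.exists_subset_card_eq h1
    left
    refine M.closure_subset_closure ?_ (hspan T' (hT'sub.trans (Finset.filter_subset _ _)) hT'card)
    intro x hx
    have hx' := hT'sub hx
    rw [Finset.mem_filter] at hx'
    exact hx'.2

/-- Theorem F's step at `(p + 1, q + 1)` for an element spanned by one side of every partition (no `e`-free partition):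
from `RLS (M ＼ {e}) (p+1) (q+1)` and `RLS (M ／ {e}) p q`. -/
theorem RLS_of_unspanned_q (M : Matroid α) [M.Finite] {p q : ℕ} {e : α} (he : M.Indep {e})
    (hunsp : ∀ A ⊆ M.E \ {e}, e ∈ M.closure A ∨ e ∈ M.closure ((M.E \ {e}) \ A))
    (h1 : RLS (M ＼ {e}) (p + 1) (q + 1)) (h2 : RLS (M ／ {e}) p q) : RLS M (p + 1) (q + 1) := by
  unfold RLS at h1 h2 ⊢
  exact c025_step_of_delete_contract he hunsp p q h1 h2

/-- **The `|E|`-induction wrapper at level `q + 1`** (p2's `rls_two_all` lifted): given `C025` at level `q` for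
every `p ≥ q + 2` (`hprev`) and the SIMPLE, RANK-`p`, COLOOP-FREE core at level `q + 1` (`hcore`), `C025` holds
at level `q + 1` for every finite matroid and every `p ≥ q + 3`. Cases: a loop halves; a parallel pair is Theorem F
with the induction hypothesis at `(p, q+1)` and `hprev` at `(p − 1, q)`; `r(E) < p` is empty; `r(E) > p` is
truncated to rank `p` (Theorem K); a coloop at `r(E) = p` is Lemma J₂ with the induction hypothesis at
`(p − 1, q + 1)` (trivial when `p − 1 = q + 2`); an element `e` spanned by one side of EVERY partition of `E ∖ {e}`
(no `e`-free partition — e.g. on a line with `≥ 4` points, `spans_of_pigeonhole`) is Theorem F with `D_e = 0`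
(`RLS_of_unspanned_q`); otherwise `hcore`, which may therefore assume that every element admits an `e`-free partition. -/
theorem rls_succ_all (q : ℕ)
    (hprev : ∀ (M : Matroid α) [M.Finite] (p : ℕ), q + 2 ≤ p → RLS M p q)
    (hcore : ∀ (M : Matroid α) [M.Finite] (p : ℕ), q + 3 ≤ p →
      (∀ e ∈ M.E, ∀ f ∈ M.E, e ≠ f → M.eRk {e, f} = 2) → M.eRank = (p : ℕ∞) →
      (∀ e, ¬ M.IsColoop e) →
      (∀ e ∈ M.E, ∃ A ⊆ M.E \ {e}, e ∉ M.closure A ∧ e ∉ M.closure ((M.E \ {e}) \ A)) →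
      RLS M p (q + 1)) :
    ∀ (M : Matroid α) [M.Finite] (p : ℕ), q + 3 ≤ p → RLS M p (q + 1) := by
  suffices H : ∀ n : ℕ, ∀ (M : Matroid α) [M.Finite], M.E.ncard = n → ∀ p : ℕ, q + 3 ≤ p →
      RLS M p (q + 1) from fun M _ p hp => H _ M rfl p hp
  intro n
  induction n using Nat.strong_induction_on with
  | _ n ih =>
  intro M _ hn p hp
  classical
  have hdel : ∀ e ∈ M.E, (M ＼ {e}).E.ncard < n := by
    intro e he
    rw [_root_.Matroid.delete_ground, ← hn, ← Set.ncard_sdiff_singleton_add_one he M.ground_finite]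
    omega
  -- Case 1: a loop
  by_cases hL : ∃ e ∈ M.E, M.IsLoop e
  · obtain ⟨e, he, hloopE⟩ := hL
    exact RLS_of_loop_q M hloopE p (q + 1) (ih _ (hdel e he) (M ＼ {e}) rfl p hp)
  push Not at hL
  -- Case 2: a parallel pair
  by_cases hP : ∃ e ∈ M.E, ∃ e' ∈ M.E, e' ≠ e ∧ e ∈ M.closure {e'}
  · obtain ⟨e, he, e', he', hne, hpar⟩ := hP
    have heI : M.Indep {e} := _root_.Matroid.indep_singleton.2 ((_root_.Matroid.not_isLoop_iff he).1 (hL e he))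
    obtain ⟨p', rfl⟩ : ∃ p', p = p' + 1 := ⟨p - 1, by omega⟩
    exact RLS_of_parallel_q M heI he' hne hpar (ih _ (hdel e he) (M ＼ {e}) rfl (p' + 1) hp)
      (hprev (M ／ {e}) p' (by omega))
  push Not at hP
  -- Case 3: simple
  have hs : ∀ e ∈ M.E, ∀ f ∈ M.E, e ≠ f → M.eRk {e, f} = 2 :=
    fun e he f hf hef => eRk_pair_eq_two_of_simple M hL (fun e he e' he' hne => hP e he e' he' hne) he hf hef
  rcases lt_trichotomy M.eRank (p : ℕ∞) with hlt | heq | hgt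
  · exact RLS_of_eRank_lt M hlt
  · -- `r(E) = p`
    by_cases hC : ∃ e, M.IsColoop e
    · obtain ⟨e, hcol⟩ := hC
      obtain ⟨p', rfl⟩ : ∃ p', p = p' + 1 := ⟨p - 1, by omega⟩
      refine RLS_of_coloop_q M (by omega) hcol heq ?_
      rcases Nat.lt_or_ge (q + 2) p' with h | h
      · exact ih _ (hdel e hcol.mem_ground) (M ＼ {e}) rfl p' (by omega)
      · exact RLS_of_le (M ＼ {e}) (by omega)
    · push Not at hC
      -- an element without an `e`-free partition closes the step
      by_cases hU : ∃ e ∈ M.E, ∀ A ⊆ M.E \ {e}, e ∈ M.closure A ∨ e ∈ M.closure ((M.E \ {e}) \ A)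
      · obtain ⟨e, he, hunsp⟩ := hU
        have heI : M.Indep {e} := _root_.Matroid.indep_singleton.2 ((_root_.Matroid.not_isLoop_iff he).1 (hL e he))
        obtain ⟨p', rfl⟩ : ∃ p', p = p' + 1 := ⟨p - 1, by omega⟩
        exact RLS_of_unspanned_q M heI hunsp (ih _ (hdel e he) (M ＼ {e}) rfl (p' + 1) hp)
          (hprev (M ／ {e}) p' (by omega))
      · push Not at hU
        exact hcore M p hp hs heq hC (fun e he => by
          obtain ⟨A, hA, h⟩ := hU e he
          exact ⟨A, hA, h.1, h.2⟩)
  · -- `r(E) > p`: truncate, then the same dichotomy on the truncation (same ground set, so the same size)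
    have hp2 : 2 ≤ p := by omega
    set T := Matroid.truncate M p with hTdef
    have hTs := truncate_pair_eRk M hp2 hs
    have hTR := truncate_eRank_eq M hgt
    have hTc := truncate_no_coloop M hgt
    have hTE : T.E = M.E := Matroid.truncate_ground M p
    have hT : RLS T p (q + 1) := by
      by_cases hU : ∃ e ∈ T.E, ∀ A ⊆ T.E \ {e}, e ∈ T.closure A ∨ e ∈ T.closure ((T.E \ {e}) \ A)
      · obtain ⟨e, he, hunsp⟩ := hU
        have heT : T.Indep {e} := by
          rw [Matroid.truncate_indep_iff]
          refine ⟨_root_.Matroid.indep_singleton.2 ((_root_.Matroid.not_isLoop_iff (hTE ▸ he)).1 (hL e (hTE ▸ he))), ?_⟩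
          rw [Set.ncard_singleton]; omega
        have hdelT : (T ＼ {e}).E.ncard < n := by
          rw [_root_.Matroid.delete_ground, hTE, ← hn, ← Set.ncard_sdiff_singleton_add_one (hTE ▸ he) M.ground_finite]
          omega
        obtain ⟨p', rfl⟩ : ∃ p', p = p' + 1 := ⟨p - 1, by omega⟩
        exact RLS_of_unspanned_q T heT hunsp (ih _ hdelT (T ＼ {e}) rfl (p' + 1) hp)
          (hprev (T ／ {e}) p' (by omega))
      · push Not at hU
        exact hcore T p hp hTs hTR hTc (fun e he => by
          obtain ⟨A, hA, h⟩ := hU e he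
          exact ⟨A, hA, h.1, h.2⟩)
    unfold RLS at hT ⊢
    exact Matroid.rls_of_truncate M p (by omega) (phiK p (q + 1)) (by unfold phiK; positivity) hT

/-- **`C025` at `q = 3` from the simple coloop-free rank-`p` core** (level `2` is Theorem N `c025_of_q_two`): if
every simple coloop-free matroid of rank `p ≥ 5` in which every element admits an `e`-free partition satisfies the
body at `(p, 3)`, then every finite matroid does, for every `p ≥ 5`. -/
theorem c025_three_of_core
    (hcore : ∀ (M : Matroid α) [M.Finite] (p : ℕ), 5 ≤ p →
      (∀ e ∈ M.E, ∀ f ∈ M.E, e ≠ f → M.eRk {e, f} = 2) → M.eRank = (p : ℕ∞) →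
      (∀ e, ¬ M.IsColoop e) →
      (∀ e ∈ M.E, ∃ A ⊆ M.E \ {e}, e ∉ M.closure A ∧ e ∉ M.closure ((M.E \ {e}) \ A)) → RLS M p 3) :
    ∀ (M : Matroid α) [M.Finite] (p : ℕ), 5 ≤ p → RLS M p 3 :=
  rls_succ_all 2 (fun M _ p hp => c025_two_all M p hp) hcore

end ThmN

end PercRepro
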